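import Summits.QuantumFields.YangMills.Theorems.UnitScaleTiltHistoryTailOneSupplier
import HarnessLib

/-!
# `AlphaInputsT3ACMinimiserPinKnitRecChiOfT8` — THE (T)-FEED OF THE READ-LOCAL 2′χ DISPLAY AT A PRESCRIBED `B₃`: the constants shell of
# `AlphaInputsT3AC.PinnedPartsT3ACRecR L` ∕ `…RecRChi L` for a record with EXACT profile and `𝔠.B₃ = B` for ANY `B ≥ B₃ᵀ` with `1 ≤ 2B`, together with
# (T) `Thm1GlobalMinAt L a₀ a₁ 𝔠.B₃` shrunk from [Balaban1985Variational] Thm 1 at T8's constants `(a₀ᵀ, a₁ᵀ, B₃ᵀ)`; and the R-display from (T) plus the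
# supplier rows — cell `ym3-torus`, desk `ym-inputs` (INPUT-LIST v5, input I-03), seat `ym-inputs-p07`; count-neutral helper (`--supports stmt-QuantumFields-20520`)

WHY.  alpha-1's `pinnedPartsT3ACRecR_shell` (`…MinimiserPinKnitRecChi` §2) certifies the constants shell of the read-local displays `PinnedPartsT3ACRecR L` ∕
`PinnedPartsT3ACRecRChi L` with `B₃ := 1` and `a₀ = a₁ = a₁(L)`, the (T) row deleted.  The display, however, asks for (T) `Thm1GlobalMinAt L a₀ a₁ 𝔠.B₃` at the
RECORD's constants, while 19200's T8 text (`AttainmentOfExistence.thm1In8GlobalMin_of_halvingStep_of_existence`) delivers Thm 1 at ITS OWN `(a₀ᵀ, a₁ᵀ, B₃ᵀ)`.  For the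
displays of record ((FL)∕χ, Sel, SelXs) this bookkeeping is `HistoryTailOneSupplier.exists_small_window` + `pinnedPartsT3ACRecFLChi_of_thm1_rows`; THIS FILE is the
same bookkeeping for the read-local R-display (DEPMAP v3.2), so that `HistoryTailLaneTailChi.historyTailL_of_pinnedPartsRecRChi` too is fed from T8's text BY NAME.
* §1 `AlphaInputsT3AC.pinnedPartsT3ACRecR_shell_at` — for ANY model size `N`, ANY `B ≥ B₃ᵀ` with `1 ≤ 2B` and any box `(0, A₀] × (0, A₁]`: [7] constants `a₀ ≤ min(A₀, a₀ᵀ)`,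
  `a₁ ≤ min(A₁, a₁ᵀ)` with `B·a₁ ≤ a₀`, the two small-`a₁` rows and (T) `Thm1GlobalMinAt L a₀ a₁ B` (`exists_small_window`, `MinimiserPin.thm1GlobalMinAt_anti` ∕ `_mono`),
  and a threshold `b₁ ≥ 0` beyond which every profile `(b₀, p₀ ≥ 3)` is met by a record with EXACTLY that profile, `𝔠.B₃ = B`, ALL EIGHT shell rows of the display and (T)
  at `𝔠.B₃` (`exists_alphaConsts`, `exists_record_sizes_M₁`).  The record type admits any `B₃ > 0`: `AlphaConsts.B₃` is a free field, the thresholds `γ₄₆`, `γ_OO` (hence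
  `γ₀`) and `C46` that read it are DERIVED.
* §2 `AlphaInputsT3AC.pinnedPartsT3ACRecRChi_of_thm1_rows` — the R-twin of `pinnedPartsT3ACRecFLChi_of_thm1_rows`: (T) at ANY constants plus the SUPPLIER ROWS «for every
  `B ≥ B₀` with `1 ≤ 2B` and every `(a₀, a₁)` in a supplier-chosen box with `B·a₁ ≤ a₀`, the two small-`a₁` rows and `Thm1GlobalMinAt L a₀ a₁ B` (usable): thresholds beyond
  which every profile is served by a record with that profile, `𝔠.B₃ = B`, the three `C68`-rows, `7L + 3 ≤ M₁`, and per family (D6R-CHARGED) `AdaptedClassNonemptyChargedT3R`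
  and (O″χ) the χ data rows `DataRowsT3RChi` for some pinned trivial-history minimiser family whenever one exists» ⟹ `PinnedPartsT3ACRecRChi L`.
* §3 `alphaInputsT3ACv3RecChi_of_thm1_rowsR` (the registered 2′χ text, through alpha-1's `alphaInputsT3ACv3RecChi_of_pinnedPartsRecRChi`) and
  `historyTailL_of_thm1In8_rowsR_allL` : `HistoryTailL` ⇐ ⟨T8 text⟩ ∧ ⟨∀ odd `L > 1`, the R-supplier rows⟩ (through `historyTailL_of_pinnedPartsRecRChi`).
HONEST FRAMING.  Bookkeeping ∕ composition of landed theorems (restriction of quantifiers, one arithmetic witness); (T), (D6R-CHARGED) and (O″χ) stay HYPOTHESES (never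
asserted); nothing of [Balaban1985UV3]'s cluster expansion or of [Balaban1985Variational] Thm 1 is proved; def-free; count-neutral helper; registry untouched.  The R-display is
dominated by the (FL)-discharged path (`…HistoryTailOneSupplierDataRows`): this file is by-name completeness, not movement on the cruxes.  YM₃ on the three-torus is rung R3 of
the programme (UV stability ∕ continuum limit on T³), NOT the Clay problem: nothing here is a claim about d = 4, infinite volume, or a mass gap.

References: T. Bałaban, Commun. Math. Phys. 102 (1985) 277–309 [Balaban1985Variational] (Thm 1 (6)–(8) pp.278–279, Prop 7 p.299, Prop 8 p.304); Commun. Math. Phys. 102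
(1985) 255–275 [Balaban1985UV3] ((5) p.256, (7) p.257, (40)–(42) p.266, (47) p.267, (68) p.273, (71) p.273, Thm 2 p.272); C. King, Commun. Math. Phys. 102 (1986) 649–677
[King1986] ((3.12) p.657).
-/

set_option autoImplicit false

noncomputable section

namespace Summit.QuantumFields.YangMills.Theorems

open MeasureTheory Set
open scoped Matrix.Norms.L2Operator
open Literature.MathematicalPhysics.QuantumFieldTheory.Balaban1983to89
open Literature.MathematicalPhysics.QuantumFieldTheory.Balaban1983to89.T3ContinuumYM3Torus
open Literature.MathematicalPhysics.QuantumFieldTheory.Balaban1983to89.T3PrintedMinimiserExistence (Thm1GlobalMinAt)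
open Literature.MathematicalPhysics.QuantumFieldTheory.Balaban1983to89.T3LowerAlongMinimisersSplit (MinimisersIn8At)
open Literature.MathematicalPhysics.QuantumFieldTheory.Balaban1983to89.ExpMeanLog (deltaSU deltaSU_pos)
open Literature.MathematicalPhysics.QuantumFieldTheory.Balaban1985CMP102.Setting
open Summit.QuantumFields.Balaban3D.Carriers
open Summit.QuantumFields.Balaban3D.Proofs.Primitives
open Summit.QuantumFields.Balaban3D.Proofs.Thresholds (Q0 Q0_pos)
open B7Prop2Explicit (C0 C0_pos)

/-! ## §1 The constants shell at a prescribed `B₃`, with (T) -/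

section Shell

/-- ★ **THE CONSTANTS SHELL OF `PinnedPartsT3ACRecR L` ∕ `PinnedPartsT3ACRecRChi L` AT A PRESCRIBED `B₃`, WITH (T).**  From [Balaban1985Variational] Thm 1 (global
reading) at constants `(a₀ᵀ, a₁ᵀ, B₃ᵀ)` with `a₀ᵀ, a₁ᵀ > 0`: for every model size `N`, every `B ≥ B₃ᵀ` with `1 ≤ 2B` and every box `(0, A₀] × (0, A₁]` there are [7]
constants `0 < a₀ ≤ min(A₀, a₀ᵀ)`, `0 < a₁ ≤ min(A₁, a₁ᵀ)` with `B·a₁ ≤ a₀`, the two small-`a₁` rows (`143·(7²/4)²·2Ba₁ ≤ ⅓`, `4Ba₁ ≤ 2δ_SU(2)/(7L)²`) and (T)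
`Thm1GlobalMinAt L a₀ a₁ B` (antitone in `(a₀, a₁)`, monotone in `B₃`), and a threshold `b₁ ≥ 0` such that every profile `b₀ ≥ b₁`, `p₀ ≥ 3` is met by a record `𝔠` with
EXACTLY that p-function, `𝔠.B₃ = B`, and ALL EIGHT shell rows of the display — `B₃a₁ ≤ a₀`, the two small-`a₁` rows, `1 ≤ 2B₃`, `4B₃L²·avgWindowFactor(L) ≤ C68`,
`e^{p₀−1} ≤ 3C₀(3)·C68·b₀Q₀(p₀)`, `b₀Q₀(p₀)·(2L²·avgWindowFactor(L))² ≤ 3C₀(3)·C68·a₁²`, `7L + 3 ≤ M₁` — together with (T) at `𝔠.B₃`.  (`pinnedPartsT3ACRecR_shell`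
generalised from `B₃ := 1`: `HistoryTailOneSupplier.exists_small_window`, `MinimiserPin.thm1GlobalMinAt_anti` ∕ `thm1GlobalMinAt_mono`, `exists_alphaConsts`,
`exists_record_sizes_M₁`.)  The (T) hypothesis is displayed, never asserted.
[cite: Balaban1985Variational, Thm 1 (6)–(8) pp.278–279 («a₀, a₁, B₃ depend on d and L only»); Balaban1985UV3, (7) p.257, (40) p.266 and (68) p.273 (bookkeeping)] -/
theorem AlphaInputsT3AC.pinnedPartsT3ACRecR_shell_at {L : ℕ} (hL : 1 < L) (N : ℕ)
    {aT₀ aT₁ BT : ℝ} (haT₀ : 0 < aT₀) (haT₁ : 0 < aT₁) (hT : Thm1GlobalMinAt L aT₀ aT₁ BT)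
    {B A₀ A₁ : ℝ} (hBT : BT ≤ B) (h2B : 1 ≤ 2 * B) (hA₀ : 0 < A₀) (hA₁ : 0 < A₁) :
    ∃ a₀ a₁ : ℝ, 0 < a₀ ∧ a₀ ≤ A₀ ∧ a₀ ≤ aT₀ ∧ 0 < a₁ ∧ a₁ ≤ A₁ ∧ a₁ ≤ aT₁ ∧ B * a₁ ≤ a₀ ∧
      (143 * ((((3 + 4 : ℕ) : ℝ)) ^ 2 / 4) ^ 2) * (2 * (B * a₁)) ≤ 1 / 3 ∧
      2 * (2 * (B * a₁)) ≤ 2 * deltaSU (Fin 2) / (((3 + 4) * L : ℕ) : ℝ) ^ 2 ∧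
      Thm1GlobalMinAt L a₀ a₁ B ∧
      ∃ b₁ : ℝ, 0 ≤ b₁ ∧ ∀ (b₀ p₀ : ℝ), b₁ ≤ b₀ → 3 ≤ p₀ →
        ∃ 𝔠 : AlphaConsts L N, 𝔠.b₀ = b₀ ∧ 𝔠.p₀ = p₀ ∧ 𝔠.B₃ = B ∧ 𝔠.B₃ * a₁ ≤ a₀ ∧
          (143 * ((((3 + 4 : ℕ) : ℝ)) ^ 2 / 4) ^ 2) * (2 * (𝔠.B₃ * a₁)) ≤ 1 / 3 ∧
          2 * (2 * (𝔠.B₃ * a₁)) ≤ 2 * deltaSU (Fin 2) / (((3 + 4) * L : ℕ) : ℝ) ^ 2 ∧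
          1 ≤ 2 * 𝔠.B₃ ∧ 4 * 𝔠.B₃ * (L : ℝ) ^ 2 * avgWindowFactor L ≤ 𝔠.C68 ∧
          Real.exp (𝔠.p₀ - 1) ≤ 3 * C0 3 * 𝔠.C68 * (𝔠.b₀ * Q0 𝔠.p₀) ∧
          (𝔠.b₀ * Q0 𝔠.p₀) * (2 * (L : ℝ) ^ 2 * avgWindowFactor L) ^ 2 ≤ 3 * C0 3 * 𝔠.C68 * a₁ ^ 2 ∧
          7 * L + 3 ≤ 𝔠.M₁ ∧
          Thm1GlobalMinAt L a₀ a₁ 𝔠.B₃ := by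
  have hBpos : 0 < B := by linarith
  -- the [7] constants inside the box and below T8's
  obtain ⟨a₀, a₁, ha₀, ha₀A, ha₁, ha₁A, hwin, hA3, hA2⟩ :=
    HistoryTailOneSupplier.exists_small_window hL hBpos (lt_min hA₀ haT₀) (lt_min hA₁ haT₁)
  have hT' : Thm1GlobalMinAt L a₀ a₁ B :=
    MinimiserPin.thm1GlobalMinAt_mono
      (MinimiserPin.thm1GlobalMinAt_anti hT (ha₀A.trans (min_le_right _ _)) (ha₁A.trans (min_le_right _ _))) le_rfl hBT
  -- a seed record with `B₃ = B`, then alpha-2's sizes-with-`M₁` at the target profile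
  obtain ⟨𝔠₀, h𝔠₀⟩ := AlphaInputsT3AC.exists_alphaConsts hL N hBpos
  obtain ⟨b₁, hb₁, h⟩ := AlphaInputsT3AC.exists_record_sizes_M₁ 𝔠₀ ha₁
  refine ⟨a₀, a₁, ha₀, ha₀A.trans (min_le_left _ _), ha₀A.trans (min_le_right _ _), ha₁, ha₁A.trans (min_le_left _ _),
    ha₁A.trans (min_le_right _ _), hwin, hA3, hA2, hT', b₁, hb₁, fun b₀ p₀ hb hp => ?_⟩
  obtain ⟨𝔠, h1, h2, hB', s1, s2, s3, s4⟩ := h b₀ p₀ hb hp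
  have hB : 𝔠.B₃ = B := hB'.trans h𝔠₀
  exact ⟨𝔠, h1, h2, hB, by rw [hB]; exact hwin, by rw [hB]; exact hA3, by rw [hB]; exact hA2, by rw [hB]; exact h2B,
    s1, s2, s3, s4, by rw [hB]; exact hT'⟩

/-- **THE SHELL AT `B := max B₃ᵀ ½` FROM T8's TEXT AT ONE BLOCK SIZE** — §1 read on the first half of v5kC's `stub_thm1In8GlobalMin` text `∃ a₀ a₁ B₃ > 0,
Thm1GlobalMinAt L a₀ a₁ B₃ ∧ MinimisersIn8At L a₀ a₁ B₃` (the `MinimisersIn8At` half is not used): for every model size `N` and box `(0, A₀] × (0, A₁]`, [7] constants in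
the box with `B·a₁ ≤ a₀`, the two small-`a₁` rows, (T) at `B`, and beyond a threshold records with exact profile, `𝔠.B₃ = B`, the eight shell rows and (T) at `𝔠.B₃`.
[cite: Balaban1985Variational, Thm 1 (6)–(8) pp.278–279 and Prop 8 p.304; Balaban1985UV3, (7) p.257 and (68) p.273] -/
theorem AlphaInputsT3AC.pinnedPartsT3ACRecR_shell_of_thm1In8 {L : ℕ} (hL : 1 < L) (N : ℕ)
    (hT8 : ∃ a₀ a₁ B₃ : ℝ, 0 < a₀ ∧ 0 < a₁ ∧ 0 < B₃ ∧ Thm1GlobalMinAt L a₀ a₁ B₃ ∧ MinimisersIn8At L a₀ a₁ B₃)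
    {A₀ A₁ : ℝ} (hA₀ : 0 < A₀) (hA₁ : 0 < A₁) :
    ∃ B a₀ a₁ : ℝ, 1 ≤ 2 * B ∧ 0 < a₀ ∧ a₀ ≤ A₀ ∧ 0 < a₁ ∧ a₁ ≤ A₁ ∧ B * a₁ ≤ a₀ ∧
      (143 * ((((3 + 4 : ℕ) : ℝ)) ^ 2 / 4) ^ 2) * (2 * (B * a₁)) ≤ 1 / 3 ∧
      2 * (2 * (B * a₁)) ≤ 2 * deltaSU (Fin 2) / (((3 + 4) * L : ℕ) : ℝ) ^ 2 ∧
      Thm1GlobalMinAt L a₀ a₁ B ∧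
      ∃ b₁ : ℝ, 0 ≤ b₁ ∧ ∀ (b₀ p₀ : ℝ), b₁ ≤ b₀ → 3 ≤ p₀ →
        ∃ 𝔠 : AlphaConsts L N, 𝔠.b₀ = b₀ ∧ 𝔠.p₀ = p₀ ∧ 𝔠.B₃ = B ∧ 𝔠.B₃ * a₁ ≤ a₀ ∧
          (143 * ((((3 + 4 : ℕ) : ℝ)) ^ 2 / 4) ^ 2) * (2 * (𝔠.B₃ * a₁)) ≤ 1 / 3 ∧
          2 * (2 * (𝔠.B₃ * a₁)) ≤ 2 * deltaSU (Fin 2) / (((3 + 4) * L : ℕ) : ℝ) ^ 2 ∧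
          1 ≤ 2 * 𝔠.B₃ ∧ 4 * 𝔠.B₃ * (L : ℝ) ^ 2 * avgWindowFactor L ≤ 𝔠.C68 ∧
          Real.exp (𝔠.p₀ - 1) ≤ 3 * C0 3 * 𝔠.C68 * (𝔠.b₀ * Q0 𝔠.p₀) ∧
          (𝔠.b₀ * Q0 𝔠.p₀) * (2 * (L : ℝ) ^ 2 * avgWindowFactor L) ^ 2 ≤ 3 * C0 3 * 𝔠.C68 * a₁ ^ 2 ∧
          7 * L + 3 ≤ 𝔠.M₁ ∧
          Thm1GlobalMinAt L a₀ a₁ 𝔠.B₃ := by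
  obtain ⟨aT₀, aT₁, BT, haT₀, haT₁, -, hT, -⟩ := hT8
  have hBT : BT ≤ max BT (1 / 2) := le_max_left _ _
  have h2B : 1 ≤ 2 * max BT (1 / 2) := by
    have := le_max_right BT (1 / 2)
    linarith
  obtain ⟨a₀, a₁, ha₀, ha₀A, -, ha₁, ha₁A, -, hwin, hA3, hA2, hT', hrec⟩ :=
    AlphaInputsT3AC.pinnedPartsT3ACRecR_shell_at hL N haT₀ haT₁ hT hBT h2B hA₀ hA₁
  exact ⟨max BT (1 / 2), a₀, a₁, h2B, ha₀, ha₀A, ha₁, ha₁A, hwin, hA3, hA2, hT', hrec⟩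

end Shell

/-! ## §2 The read-local R-display from (T) at any constants and the supplier rows -/

section Display

/-- ★★ **THE READ-LOCAL 2′χ DISPLAY `PinnedPartsT3ACRecRChi L` FROM (T) AT ANY CONSTANTS AND THE SUPPLIER ROWS** (the R-twin of
`HistoryTailOneSupplier.pinnedPartsT3ACRecFLChi_of_thm1_rows`).  Hypotheses: `hT` — [Balaban1985Variational] Thm 1 (global reading) at SOME `(a₀, a₁, B₃) > 0` (the first
half of the T8 text); `hrows` — for every `B ≥ B₀` with `1 ≤ 2B` and every `(a₀, a₁) ∈ (0, A₀] × (0, A₁]` with `B·a₁ ≤ a₀`, the two small-`a₁` rows and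
`Thm1GlobalMinAt L a₀ a₁ B` (usable), thresholds `(b₁, p₁)` beyond which every profile is served by a record with exactly that profile, `B₃ = B`, the three `C68`-rows,
`7L + 3 ≤ M₁`, and per family (D6R-CHARGED) `AdaptedClassNonemptyChargedT3R` and (O″χ) the χ data rows `DataRowsT3RChi` for some pinned trivial-history minimiser family
whenever one exists.  Conclusion: `PinnedPartsT3ACRecRChi L`.  (`B := max (max B₃ᵀ B₀) ½`; `exists_small_window`; `thm1GlobalMinAt_anti` ∕ `_mono`.)
[cite: Balaban1985Variational, Thm 1 (6)–(8) pp.278–279; Balaban1985UV3, (7) p.257, (40)–(42) p.266, (47) p.267, (68) p.273 and Thm 2 p.272] -/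
theorem AlphaInputsT3AC.pinnedPartsT3ACRecRChi_of_thm1_rows {L : ℕ} (hL : 1 < L)
    (hT : ∃ a₀ a₁ B₃ : ℝ, 0 < a₀ ∧ 0 < a₁ ∧ 0 < B₃ ∧ Thm1GlobalMinAt L a₀ a₁ B₃)
    {B₀ A₀ A₁ : ℝ} (hA₀ : 0 < A₀) (hA₁ : 0 < A₁)
    (hrows : ∀ (B a₀ a₁ : ℝ), B₀ ≤ B → 1 ≤ 2 * B → 0 < a₀ → a₀ ≤ A₀ → 0 < a₁ → a₁ ≤ A₁ → B * a₁ ≤ a₀ →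
      (143 * ((((3 + 4 : ℕ) : ℝ)) ^ 2 / 4) ^ 2) * (2 * (B * a₁)) ≤ 1 / 3 →
      2 * (2 * (B * a₁)) ≤ 2 * deltaSU (Fin 2) / (((3 + 4) * L : ℕ) : ℝ) ^ 2 →
      Thm1GlobalMinAt L a₀ a₁ B →
      ∃ (b₁ p₁ : ℝ), ∀ (b₀ p₀ : ℝ), b₁ ≤ b₀ → p₁ ≤ p₀ →
        ∃ 𝔠 : AlphaConsts L (suGroupModel 2).N, 𝔠.b₀ = b₀ ∧ 𝔠.p₀ = p₀ ∧ 𝔠.B₃ = B ∧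
          4 * 𝔠.B₃ * (L : ℝ) ^ 2 * avgWindowFactor L ≤ 𝔠.C68 ∧
          Real.exp (𝔠.p₀ - 1) ≤ 3 * C0 3 * 𝔠.C68 * (𝔠.b₀ * Q0 𝔠.p₀) ∧
          (𝔠.b₀ * Q0 𝔠.p₀) * (2 * (L : ℝ) ^ 2 * avgWindowFactor L) ^ 2 ≤ 3 * C0 3 * 𝔠.C68 * a₁ ^ 2 ∧
          7 * L + 3 ≤ 𝔠.M₁ ∧
          ∀ (F : T3Family) (hF : F.L = L),
            (∀ (γ : ℝ) (hγ : 0 < γ) (hγ1 : γ ≤ (min (hF ▸ 𝔠).gamma0 1) ^ 2) (K : ℕ),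
              AlphaInputsT3AC.AdaptedClassNonemptyChargedT3R F (hF ▸ 𝔠) γ hγ hγ1 K) ∧
            (∀ (γ : ℝ) (hγ : 0 < γ) (hγ1 : γ ≤ (min (hF ▸ 𝔠).gamma0 1) ^ 2) (K : ℕ),
              (∃ Ut : (k : ℕ) → GaugeField (F.P K) k (Matrix.specialUnitaryGroup (Fin 2) ℂ) →
                  GaugeField (F.P K) 0 (Matrix.specialUnitaryGroup (Fin 2) ℂ),
                AlphaInputsT3AC.TrivMinimiserRowsT3 F (hF ▸ 𝔠) γ hγ hγ1 a₀ a₁ K Ut) →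
              ∃ Ut : (k : ℕ) → GaugeField (F.P K) k (Matrix.specialUnitaryGroup (Fin 2) ℂ) →
                  GaugeField (F.P K) 0 (Matrix.specialUnitaryGroup (Fin 2) ℂ),
                AlphaInputsT3AC.TrivMinimiserRowsT3 F (hF ▸ 𝔠) γ hγ hγ1 a₀ a₁ K Ut ∧
                  AlphaInputsT3AC.DataRowsT3RChi F (hF ▸ 𝔠) γ hγ hγ1 K Ut)) :
    AlphaInputsT3AC.PinnedPartsT3ACRecRChi L := by
  obtain ⟨aT₀, aT₁, BT, haT₀, haT₁, hBT, hT⟩ := hT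
  -- the record's `B₃`: above T8's `B₃`, the supplier's floor and `½`
  set B : ℝ := max (max BT B₀) (1 / 2) with hB_def
  have hBT_le : BT ≤ B := (le_max_left _ _).trans (le_max_left _ _)
  have hB₀_le : B₀ ≤ B := (le_max_right _ _).trans (le_max_left _ _)
  have hBhalf : 1 / 2 ≤ B := le_max_right _ _
  have hBpos : 0 < B := lt_of_lt_of_le (by norm_num) hBhalf
  have h2B : 1 ≤ 2 * B := by linarith
  -- the [7] constants inside the box and below T8's
  obtain ⟨a₀, a₁, ha₀, ha₀A, ha₁, ha₁A, hwin, hA3, hA2⟩ :=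
    HistoryTailOneSupplier.exists_small_window hL hBpos (lt_min hA₀ haT₀) (lt_min hA₁ haT₁)
  have hT' : Thm1GlobalMinAt L a₀ a₁ B :=
    MinimiserPin.thm1GlobalMinAt_mono
      (MinimiserPin.thm1GlobalMinAt_anti hT (ha₀A.trans (min_le_right _ _)) (ha₁A.trans (min_le_right _ _))) le_rfl hBT_le
  obtain ⟨b₁, p₁, hrec⟩ := hrows B a₀ a₁ hB₀_le h2B ha₀ (ha₀A.trans (min_le_left _ _)) ha₁ (ha₁A.trans (min_le_left _ _))
    hwin hA3 hA2 hT'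
  refine ⟨b₁, p₁, fun b₀ p₀ hb hp => ?_⟩
  obtain ⟨𝔠, h1, h2, hB3, s1, s2, s3, s4, hFO⟩ := hrec b₀ p₀ hb hp
  refine ⟨𝔠, a₀, a₁, h1, h2, ha₀, ha₁, by rw [hB3]; exact hwin, by rw [hB3]; exact hA3, by rw [hB3]; exact hA2,
    by rw [hB3]; exact h2B, s1, s2, s3, s4, by rw [hB3]; exact hT', fun F hF => hFO F hF⟩

/-- ★★ **THE REGISTERED 2′χ TEXT `AlphaInputsT3ACv3RecChi L` FROM (T) AT ANY CONSTANTS AND THE R-SUPPLIER ROWS** (§2 through alpha-1's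
`alphaInputsT3ACv3RecChi_of_pinnedPartsRecRChi`); 20520's v5kC reads it identically (2′χ's (T) row is T8's first half there too).
[cite: Balaban1985UV3, Thm 2 p.272 and (47) p.267; Balaban1985Variational, Thm 1 (8) p.279] -/
theorem alphaInputsT3ACv3RecChi_of_thm1_rowsR {L : ℕ} (hL : 1 < L)
    (hT : ∃ a₀ a₁ B₃ : ℝ, 0 < a₀ ∧ 0 < a₁ ∧ 0 < B₃ ∧ Thm1GlobalMinAt L a₀ a₁ B₃)
    {B₀ A₀ A₁ : ℝ} (hA₀ : 0 < A₀) (hA₁ : 0 < A₁)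
    (hrows : ∀ (B a₀ a₁ : ℝ), B₀ ≤ B → 1 ≤ 2 * B → 0 < a₀ → a₀ ≤ A₀ → 0 < a₁ → a₁ ≤ A₁ → B * a₁ ≤ a₀ →
      (143 * ((((3 + 4 : ℕ) : ℝ)) ^ 2 / 4) ^ 2) * (2 * (B * a₁)) ≤ 1 / 3 →
      2 * (2 * (B * a₁)) ≤ 2 * deltaSU (Fin 2) / (((3 + 4) * L : ℕ) : ℝ) ^ 2 →
      Thm1GlobalMinAt L a₀ a₁ B →
      ∃ (b₁ p₁ : ℝ), ∀ (b₀ p₀ : ℝ), b₁ ≤ b₀ → p₁ ≤ p₀ →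
        ∃ 𝔠 : AlphaConsts L (suGroupModel 2).N, 𝔠.b₀ = b₀ ∧ 𝔠.p₀ = p₀ ∧ 𝔠.B₃ = B ∧
          4 * 𝔠.B₃ * (L : ℝ) ^ 2 * avgWindowFactor L ≤ 𝔠.C68 ∧
          Real.exp (𝔠.p₀ - 1) ≤ 3 * C0 3 * 𝔠.C68 * (𝔠.b₀ * Q0 𝔠.p₀) ∧
          (𝔠.b₀ * Q0 𝔠.p₀) * (2 * (L : ℝ) ^ 2 * avgWindowFactor L) ^ 2 ≤ 3 * C0 3 * 𝔠.C68 * a₁ ^ 2 ∧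
          7 * L + 3 ≤ 𝔠.M₁ ∧
          ∀ (F : T3Family) (hF : F.L = L),
            (∀ (γ : ℝ) (hγ : 0 < γ) (hγ1 : γ ≤ (min (hF ▸ 𝔠).gamma0 1) ^ 2) (K : ℕ),
              AlphaInputsT3AC.AdaptedClassNonemptyChargedT3R F (hF ▸ 𝔠) γ hγ hγ1 K) ∧
            (∀ (γ : ℝ) (hγ : 0 < γ) (hγ1 : γ ≤ (min (hF ▸ 𝔠).gamma0 1) ^ 2) (K : ℕ),
              (∃ Ut : (k : ℕ) → GaugeField (F.P K) k (Matrix.specialUnitaryGroup (Fin 2) ℂ) →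
                  GaugeField (F.P K) 0 (Matrix.specialUnitaryGroup (Fin 2) ℂ),
                AlphaInputsT3AC.TrivMinimiserRowsT3 F (hF ▸ 𝔠) γ hγ hγ1 a₀ a₁ K Ut) →
              ∃ Ut : (k : ℕ) → GaugeField (F.P K) k (Matrix.specialUnitaryGroup (Fin 2) ℂ) →
                  GaugeField (F.P K) 0 (Matrix.specialUnitaryGroup (Fin 2) ℂ),
                AlphaInputsT3AC.TrivMinimiserRowsT3 F (hF ▸ 𝔠) γ hγ hγ1 a₀ a₁ K Ut ∧
                  AlphaInputsT3AC.DataRowsT3RChi F (hF ▸ 𝔠) γ hγ hγ1 K Ut)) :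
    AlphaInputsT3ACv3RecChi L :=
  alphaInputsT3ACv3RecChi_of_pinnedPartsRecRChi (AlphaInputsT3AC.pinnedPartsT3ACRecRChi_of_thm1_rows hL hT hA₀ hA₁ hrows)

end Display

/-! ## §3 The crux from T8's text and the R-supplier rows at every odd block size -/

section Crux

/-- ★★ **`HistoryTailL` ⇐ ⟨v5kC's `stub_thm1In8GlobalMin` TEXT⟩ ∧ (∀ odd `L > 1`, THE R-SUPPLIER ROWS)** — stmt-QuantumFields-19936 BY NAME from 19200's T8 text (whose
`MinimisersIn8At` half is not used) and, at every odd block size, a floor `B₀` and a box `(0, A₀] × (0, A₁]` on which the (D6R-CHARGED) + (O″χ)-R rows are served (§2, then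
`HistoryTailLaneTailChi.historyTailL_of_pinnedPartsRecRChi`).  PROVED MODULO the two displayed hypotheses, not a proof of the crux; the (FL)-discharged closer
`HistoryTailOneSupplier.historyTailL_of_thm1In8_dataRows_allL` needs strictly less.
[cite: Balaban1985UV3, (5) p.256, (47) p.267, (71) p.273 and Thm 2 p.272; Balaban1985Variational, Thm 1 (8) p.279 and Prop 8 p.304; King1986, (3.12) p.657] -/
theorem historyTailL_of_thm1In8_rowsR_allL
    (hT8 : ∀ L : ℕ, Odd L → 1 < L → ∃ a₀ a₁ B₃ : ℝ, 0 < a₀ ∧ 0 < a₁ ∧ 0 < B₃ ∧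
      Thm1GlobalMinAt L a₀ a₁ B₃ ∧ MinimisersIn8At L a₀ a₁ B₃)
    (hrows : ∀ L : ℕ, Odd L → 1 < L → ∃ (B₀ A₀ A₁ : ℝ), 0 < A₀ ∧ 0 < A₁ ∧
      ∀ (B a₀ a₁ : ℝ), B₀ ≤ B → 1 ≤ 2 * B → 0 < a₀ → a₀ ≤ A₀ → 0 < a₁ → a₁ ≤ A₁ → B * a₁ ≤ a₀ →
        (143 * ((((3 + 4 : ℕ) : ℝ)) ^ 2 / 4) ^ 2) * (2 * (B * a₁)) ≤ 1 / 3 →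
        2 * (2 * (B * a₁)) ≤ 2 * deltaSU (Fin 2) / (((3 + 4) * L : ℕ) : ℝ) ^ 2 →
        Thm1GlobalMinAt L a₀ a₁ B →
        ∃ (b₁ p₁ : ℝ), ∀ (b₀ p₀ : ℝ), b₁ ≤ b₀ → p₁ ≤ p₀ →
          ∃ 𝔠 : AlphaConsts L (suGroupModel 2).N, 𝔠.b₀ = b₀ ∧ 𝔠.p₀ = p₀ ∧ 𝔠.B₃ = B ∧
            4 * 𝔠.B₃ * (L : ℝ) ^ 2 * avgWindowFactor L ≤ 𝔠.C68 ∧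
            Real.exp (𝔠.p₀ - 1) ≤ 3 * C0 3 * 𝔠.C68 * (𝔠.b₀ * Q0 𝔠.p₀) ∧
            (𝔠.b₀ * Q0 𝔠.p₀) * (2 * (L : ℝ) ^ 2 * avgWindowFactor L) ^ 2 ≤ 3 * C0 3 * 𝔠.C68 * a₁ ^ 2 ∧
            7 * L + 3 ≤ 𝔠.M₁ ∧
            ∀ (F : T3Family) (hF : F.L = L),
              (∀ (γ : ℝ) (hγ : 0 < γ) (hγ1 : γ ≤ (min (hF ▸ 𝔠).gamma0 1) ^ 2) (K : ℕ),
                AlphaInputsT3AC.AdaptedClassNonemptyChargedT3R F (hF ▸ 𝔠) γ hγ hγ1 K) ∧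
              (∀ (γ : ℝ) (hγ : 0 < γ) (hγ1 : γ ≤ (min (hF ▸ 𝔠).gamma0 1) ^ 2) (K : ℕ),
                (∃ Ut : (k : ℕ) → GaugeField (F.P K) k (Matrix.specialUnitaryGroup (Fin 2) ℂ) →
                    GaugeField (F.P K) 0 (Matrix.specialUnitaryGroup (Fin 2) ℂ),
                  AlphaInputsT3AC.TrivMinimiserRowsT3 F (hF ▸ 𝔠) γ hγ hγ1 a₀ a₁ K Ut) →
                ∃ Ut : (k : ℕ) → GaugeField (F.P K) k (Matrix.specialUnitaryGroup (Fin 2) ℂ) →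
                    GaugeField (F.P K) 0 (Matrix.specialUnitaryGroup (Fin 2) ℂ),
                  AlphaInputsT3AC.TrivMinimiserRowsT3 F (hF ▸ 𝔠) γ hγ hγ1 a₀ a₁ K Ut ∧
                    AlphaInputsT3AC.DataRowsT3RChi F (hF ▸ 𝔠) γ hγ hγ1 K Ut)) :
    Summit.QuantumFields.YangMills.Theses.UnitScaleTilt.HistoryTailL := by
  refine HistoryTailLaneTailChi.historyTailL_of_pinnedPartsRecRChi fun L hLo hL => ?_
  obtain ⟨a₀, a₁, B₃, ha₀, ha₁, hB₃, hT, -⟩ := hT8 L hLo hL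
  obtain ⟨B₀, A₀, A₁, hA₀, hA₁, h⟩ := hrows L hLo hL
  exact AlphaInputsT3AC.pinnedPartsT3ACRecRChi_of_thm1_rows hL ⟨a₀, a₁, B₃, ha₀, ha₁, hB₃, hT⟩ hA₀ hA₁ h

end Crux

end Summit.QuantumFields.YangMills.Theorems

end
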